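import Mathlib.Algebra.Group.Subgroup.Pointwise
import Mathlib.Tactic.Group

/-!
# EG coset lemma (abstract group theory) — bsd-idea-13 g8, context `stub_muOneSign_ns` (stmt-BirchSwinnertonDyer-19002)

HONEST FRAMING. Pure group theory, sorry-free. Nothing about BSD, the crux
`KobayashiMainConjectureSmallImage`, or any stub of `Lines/birth_acns.lean` is proved here.

This is the structural step (★★) ⟸ EG(N,p) of the memo `EG-REDUCTION-g8.md`:
for subgroups `B⁺ B⁻ Γ` of a group `G` (think `G = Δ′ ⊆ Γ₀(N)[1/p]`, `B^± = Stab(∞), Stab(0)`,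
`Γ = Γ′ = {γ ∈ Γ₀(N) : d mod N ∈ ⟨±1,p⟩}`), put `S := Γ ∩ B⁺·B⁻` (think: `S_p = {γ : d(γ) = ± p^k}`,
the elements whose cusp `γ·0` has `p`-power denominator) and `H := closure S`.  If `B⁺ ∪ B⁻`
generates `G` ("EG") and `G = Γ·B⁻ = Γ·B⁺` (transversality: `Γ` acts transitively on both cusp
classes), then every `γ ∈ Γ` lies in `H·(Γ ∩ B⁻)`; if moreover `Γ ∩ B⁻ ≤ H` (think: `±V_N^ℤ ⊆ S_p`)
then `Γ = H`, i.e. the `p`-power-cusp elements generate `Γ′`.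

Proof = connectivity of the coset graph of `(G; B⁻, B⁺)`, run as a right-multiplication induction.
-/

set_option linter.dupNamespace false

namespace Summit.BirchSwinnertonDyer.BirchSwinnertonDyer.Cruxes.KobayashiMainConjectureSmallImage.EGCoset

open Subgroup

variable {G : Type*} [Group G]

/-- The "big cell" generating set `S = Γ ∩ B⁺·B⁻`. -/
def bigCellSet (Bp Bm Γ : Subgroup G) : Set G :=
  {γ | γ ∈ Γ ∧ ∃ u ∈ Bp, ∃ v ∈ Bm, γ = u * v}

theorem bigCellSet_subset (Bp Bm Γ : Subgroup G) : bigCellSet Bp Bm Γ ⊆ (Γ : Set G) :=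
  fun _ h => h.1

theorem closure_bigCellSet_le (Bp Bm Γ : Subgroup G) :
    closure (bigCellSet Bp Bm Γ) ≤ Γ := by
  rw [closure_le]
  exact bigCellSet_subset Bp Bm Γ

/-- One step of the coset-graph walk: the invariant
`P x := (∃ h ∈ H, h⁻¹x ∈ B⁻) ∧ (∃ h ∈ H, h⁻¹x ∈ B⁺)` is stable under `x ↦ x*y`, `y ∈ B⁺ ∪ B⁻`. -/
theorem step (Bp Bm Γ : Subgroup G)
    (hTm : ∀ g : G, ∃ γ ∈ Γ, ∃ b ∈ Bm, g = γ * b)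
    (hTp : ∀ g : G, ∃ γ ∈ Γ, ∃ b ∈ Bp, g = γ * b)
    (x y : G) (hy : y ∈ (Bp : Set G) ∪ (Bm : Set G))
    (hx : (∃ h ∈ closure (bigCellSet Bp Bm Γ), h⁻¹ * x ∈ Bm) ∧
          (∃ h ∈ closure (bigCellSet Bp Bm Γ), h⁻¹ * x ∈ Bp)) :
    (∃ h ∈ closure (bigCellSet Bp Bm Γ), h⁻¹ * (x * y) ∈ Bm) ∧
    (∃ h ∈ closure (bigCellSet Bp Bm Γ), h⁻¹ * (x * y) ∈ Bp) := by
  obtain ⟨⟨h₁, hh₁, hx₁⟩, ⟨h₂, hh₂, hx₂⟩⟩ := hx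
  rcases hy with hy | hy
  · -- `y ∈ B⁺`
    have hy' : y ∈ Bp := hy
    refine ⟨?_, ⟨h₂, hh₂, by simpa [mul_assoc] using Bp.mul_mem hx₂ hy'⟩⟩
    -- `u := h₂⁻¹ x ∈ B⁺`, `u*y ∈ B⁺`; transversality: `u*y = γ*b`, `γ ∈ Γ`, `b ∈ B⁻`.
    have huy : h₂⁻¹ * x * y ∈ Bp := Bp.mul_mem hx₂ hy'
    obtain ⟨γ, hγ, b, hb, hγb⟩ := hTm (h₂⁻¹ * x * y)
    have hγS : γ ∈ bigCellSet Bp Bm Γ := by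
      refine ⟨hγ, h₂⁻¹ * x * y, huy, b⁻¹, Bm.inv_mem hb, ?_⟩
      rw [hγb]; group
    have hγH : γ ∈ closure (bigCellSet Bp Bm Γ) := subset_closure hγS
    refine ⟨h₂ * γ, (closure _).mul_mem hh₂ hγH, ?_⟩
    have : (h₂ * γ)⁻¹ * (x * y) = γ⁻¹ * (h₂⁻¹ * x * y) := by group
    rw [this, hγb]
    simpa using hb
  · -- `y ∈ B⁻`
    have hy' : y ∈ Bm := hy
    refine ⟨⟨h₁, hh₁, by simpa [mul_assoc] using Bm.mul_mem hx₁ hy'⟩, ?_⟩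
    have hvy : h₁⁻¹ * x * y ∈ Bm := Bm.mul_mem hx₁ hy'
    obtain ⟨γ, hγ, b, hb, hγb⟩ := hTp (h₁⁻¹ * x * y)
    -- `γ = (v y) b⁻¹ ∈ B⁻·B⁺`, so `γ⁻¹ = b (v y)⁻¹ ∈ B⁺·B⁻ ∩ Γ = S`.
    have hγS : γ⁻¹ ∈ bigCellSet Bp Bm Γ := by
      refine ⟨Γ.inv_mem hγ, b, hb, (h₁⁻¹ * x * y)⁻¹, Bm.inv_mem hvy, ?_⟩
      rw [hγb]; group
    have hγH : γ ∈ closure (bigCellSet Bp Bm Γ) := by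
      have h0 : γ⁻¹ ∈ closure (bigCellSet Bp Bm Γ) := subset_closure hγS
      simpa using (closure (bigCellSet Bp Bm Γ)).inv_mem h0
    refine ⟨h₁ * γ, (closure _).mul_mem hh₁ hγH, ?_⟩
    have : (h₁ * γ)⁻¹ * (x * y) = γ⁻¹ * (h₁⁻¹ * x * y) := by group
    rw [this, hγb]
    simpa using hb

/-- The walk: under EG (`B⁺ ∪ B⁻` generates `G`) and transversality, every `g : G` has its
`B⁻`-coset and its `B⁺`-coset in the `H`-orbit of the base cosets. -/
theorem exists_mem_closure_inv_mul_mem (Bp Bm Γ : Subgroup G)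
    (hgen : closure ((Bp : Set G) ∪ (Bm : Set G)) = ⊤)
    (hTm : ∀ g : G, ∃ γ ∈ Γ, ∃ b ∈ Bm, g = γ * b)
    (hTp : ∀ g : G, ∃ γ ∈ Γ, ∃ b ∈ Bp, g = γ * b)
    (g : G) :
    (∃ h ∈ closure (bigCellSet Bp Bm Γ), h⁻¹ * g ∈ Bm) ∧
    (∃ h ∈ closure (bigCellSet Bp Bm Γ), h⁻¹ * g ∈ Bp) := by
  have hg : g ∈ closure ((Bp : Set G) ∪ (Bm : Set G)) := by
    rw [hgen]; exact mem_top g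
  induction hg using closure_induction_right with
  | one =>
      exact ⟨⟨1, (closure _).one_mem, by simp⟩,
             ⟨1, (closure _).one_mem, by simp⟩⟩
  | mul_right x hx y hy ih => exact step Bp Bm Γ hTm hTp x y hy ih
  | mul_inv_cancel x hx y hy ih =>
      refine step Bp Bm Γ hTm hTp x y⁻¹ ?_ ih
      rcases hy with hy | hy
      · exact Or.inl (Bp.inv_mem hy)
      · exact Or.inr (Bm.inv_mem hy)

/-- **EG coset lemma.** Under EG and transversality, `Γ = H · (Γ ∩ B⁻)`; in the form used:
if `Γ ∩ B⁻ ≤ H` then `Γ = closure S`. -/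
theorem eq_closure_bigCellSet (Bp Bm Γ : Subgroup G)
    (hgen : closure ((Bp : Set G) ∪ (Bm : Set G)) = ⊤)
    (hTm : ∀ g : G, ∃ γ ∈ Γ, ∃ b ∈ Bm, g = γ * b)
    (hTp : ∀ g : G, ∃ γ ∈ Γ, ∃ b ∈ Bp, g = γ * b)
    (hstab : Γ ⊓ Bm ≤ closure (bigCellSet Bp Bm Γ)) :
    Γ = closure (bigCellSet Bp Bm Γ) := by
  refine le_antisymm ?_ (closure_bigCellSet_le Bp Bm Γ)
  intro γ hγ
  obtain ⟨⟨h, hh, hb⟩, -⟩ := exists_mem_closure_inv_mul_mem Bp Bm Γ hgen hTm hTp γ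
  have hΓ : h⁻¹ * γ ∈ Γ := Γ.mul_mem (Γ.inv_mem (closure_bigCellSet_le Bp Bm Γ hh)) hγ
  have hH : h⁻¹ * γ ∈ closure (bigCellSet Bp Bm Γ) := hstab ⟨hΓ, hb⟩
  have : γ = h * (h⁻¹ * γ) := by group
  rw [this]
  exact (closure _).mul_mem hh hH

/-- Same conclusion phrased as in the memo: `⟨S⟩` acts transitively on `G/B⁻`
(every `g` is `h * b` with `h ∈ closure S`, `b ∈ B⁻`). -/
theorem exists_closure_mul_eq (Bp Bm Γ : Subgroup G)
    (hgen : closure ((Bp : Set G) ∪ (Bm : Set G)) = ⊤)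
    (hTm : ∀ g : G, ∃ γ ∈ Γ, ∃ b ∈ Bm, g = γ * b)
    (hTp : ∀ g : G, ∃ γ ∈ Γ, ∃ b ∈ Bp, g = γ * b)
    (g : G) : ∃ h ∈ closure (bigCellSet Bp Bm Γ), ∃ b ∈ Bm, g = h * b := by
  obtain ⟨⟨h, hh, hb⟩, -⟩ := exists_mem_closure_inv_mul_mem Bp Bm Γ hgen hTm hTp g
  exact ⟨h, hh, h⁻¹ * g, hb, by group⟩

end Summit.BirchSwinnertonDyer.BirchSwinnertonDyer.Cruxes.KobayashiMainConjectureSmallImage.EGCoset
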